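import Summits.QuantumFields.BalabanUV.T4Continuum.Support.B13StepEnvelopeEndUniform
import Summits.QuantumFields.BalabanUV.T4Continuum.Support.B13StepEnvelopeEndMeasOp
import Summits.QuantumFields.BalabanUV.T4Continuum.Support.OutputRateWindow

/-!
# NE5 ∕ U3 — THE η-UNIFORM CAUCHY END FACE ON THE OPERATOR CARRIER OF RECORD `↥measOp` (`∃ C₅` OUTERMOST) AND THE REASSEMBLY OF
# THE η-UNIFORM CAUCHY FACES FROM SINGLETON WINDOWS (owner RULINGS R24 «instantiate per singleton `{g}` with g-indexed dictionaries,
# then reassemble», `OutputRateWindow` p216401; R29 ∕ referee INFO-27 «ONE g-uniform `C₅`»; R29′) — part 2 of 2 after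
# `B13StepEnvelopeEndUniform`

Cell `pub-balaban`, unit `b2b-balaban-t4-ne5-formalise-leaf-03` (NE5 formalisation swarm, LEAF PROVER 03, gen 7; follower of this
lineage's `Support/B13StepEnvelopeEndUniform.lean` (part 1: the η-uniform faces E9 ∕ E9[rec] ∕ E9[rec,sub]) and
`Support/B13StepEnvelopeEndMeasOp.lean` p217285, in the pattern of leaf-10's `B13StepEndArithmeticWindow` p217294 (E1 ∕ E8); journal
INTENT `CLAIMS.log` l.12800, CLAIM RULE 1).  Summits-side NEW WORK under the LEAN PLACEMENT RULE (cell bookkeeping; NOT a Literature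
module; 0 `def`, 0 cite tag); nothing landed is edited — part 1's faces, route P2's `opA_mem_measOp`∕`opB_mem_measOp`, this lineage's
`transportReads_record_readAt` and the owner's `OutputRateWindow.ne5_of_forall_singleton` are applied BY NAME.  HONEST FRAMING: rung
(B)+1 of the FINITE-VOLUME T⁴ continuum programme — NOT infinite volume, NOT a mass gap, NOT the Clay problem, and **NOT A PROOF OF
NE5** (NOT PRINTED; cell GAPS G-t4-U3-1): every theorem below is an IMPLICATION whose wall binders — W2-op = `ActOpLineAnalyticOn` at
FACTOR level over operator directions in the sub-slot (GAPS G-ne5p1-1′∕1″, NOT PRINTED; satisfiable in principle on `measOp` after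
R20, NOT discharged), the per-activity norm majorant with decay split + anchored norm ((2.38)∕(1.26) KIND), W1 in row NE2's entry
currency, W4, the one-run slice budgets (W3 KIND), the quoted levels L05∕L06 ([Balaban1987RG1] (1.18) p. 263 — SHAPE only), the
radii, the one-run measurability side conditions — are DISPLAYED HYPOTHESES, asserted nowhere (c3∕c4∕c6).  HONEST DEPENDENCY (cell
line, verbatim): continuum YM on T⁴ ⇐ BetaPertH ∧ nine spine estimates (0/9 proved); BetaPertH ⇐ (D1) ∧ (D4) ∧ CAP+tail; G-an2-4
gates asym, D1 and NE2/3/4.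

THE POINT (quantifier order).  `T4OutputRate.NE5 EA EB W κ θ C₅` is `∀ g ∈ W, …` outermost, so `NE5 … W … C₅ ↔ ∀ g ∈ W, NE5 … {g} … C₅`
with ONE `C₅` (`OutputRateWindow.ne5_iff_forall_singleton`).  Part 1's faces have `∃ C₅` OUTERMOST — the constant is fixed from the
SIZES before the pair of runs, the slot package, the sub-slot and the window are bound — so supplying every displayed binder PER
SINGLETON `{g}`, with g-INDEXED dictionaries where a binder carries one (the activity norm majorants `A g` ∕ `A′ g`, the exp-linear data
`Dt g`) and the COMMON sizes, yields `NE5` on `W` with the SAME `C₅` (§2).  The landed `∃`-after-`W` Cauchy faces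
(`exists_ne5_of_record_*envelope*`) cannot do this (R29, `OutputRateWindowBounded.grow_not_exists_uniform`).

WHAT THIS FILE PROVES (kernel; `[folklore]`; no definition):
* §1 **`uniform_ne5_of_record_measOp_envelope_readAt`** — `B13StepEnvelopeEndMeasOp.exists_ne5_of_record_measOp_envelope_readAt` (p217285:
  slot packages on row O1-b's species type read at the transported background, restricted to `measOp T κ ι Ω 𝒴`, membership
  DISCHARGED from one-run measurability) with the `∃` moved OUTERMOST: ONE `C₅` from the sizes for every pair of runs, slot package
  (`S₀.D.ω = ω`), reading `ι′`, window, roomy class and dictionaries — part 1's `uniform_ne5_of_record_restrict_envelope` at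
  `M := measOp …`.
* §2 SINGLETON WINDOWS — **`uniform_ne5_of_record_envelope_singleton`** (E9[rec]) and **`uniform_ne5_of_record_restrict_envelope_singleton`**
  (E9[rec,sub], every sub-slot `M ∋` the data of record): every displayed binder PER SINGLETON `{g}`, `g ∈ W`, g-indexed `A g`, `A′ g`,
  `Dt g`, SAME `C₅`, conclusion `NE5 (B13StepOfRecord.outA … E₀ cB) (B13StepOfRecord.outB … E₀ cB) W κ θ′ C₅`.
NOT claimed: any estimate; any value of a letter; that Bałaban's step satisfies a binder.  0 sorry; axioms ⊆ {propext, Classical.choice,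
Quot.sound}.
-/

noncomputable section

open scoped BigOperators
open Metric Set MeasureTheory

namespace Summit.QuantumFields.BalabanUV.T4Continuum.B13StepEnvelopeEndWindow

open Literature.MathematicalPhysics.QuantumFieldTheory.Balaban1983to89
open Literature.MathematicalPhysics.QuantumFieldTheory.Balaban1983to89.T4OutputRate (Carriers Functional DecayBound NE5)
open Literature.MathematicalPhysics.QuantumFieldTheory.Balaban1983to89.T4InputCauchyRateSpecies (ballClass)
open Summit.QuantumFields.BalabanUV.T4Continuum.B13Carriers (TwoRuns)
open Summit.QuantumFields.BalabanUV.T4Continuum.B13OpDatum (Format OpDatum Species FormatBounded)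
open Summit.QuantumFields.BalabanUV.T4Continuum.B13OpDatumJunctions (opOf RawBounded WeightedEntrywiseRate)
open Summit.QuantumFields.BalabanUV.T4Continuum.B13StepTermLabels (TermIdx InnerLabel)
open Summit.QuantumFields.BalabanUV.T4Continuum.B13StepTermFamily (ActData ActExpLinearOn)
open Summit.QuantumFields.BalabanUV.T4Continuum.B13StepTermSocket (labelsIndexing touchInc)
open Summit.QuantumFields.BalabanUV.T4Continuum.B13InnerData (Bnd b13InnerData)
open Summit.QuantumFields.BalabanUV.T4Continuum.UrsellTreeSum (ind)
open Summit.QuantumFields.BalabanUV.T4Continuum.UrsellTermBudget (actSum)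
open Summit.QuantumFields.BalabanUV.T4Continuum.B13Base (selfCtr)
open Summit.QuantumFields.BalabanUV.T4Continuum.B13DomainGeometryTR (SCube footprint domainGeometry)
open Summit.QuantumFields.BalabanUV.T4Continuum.B13StepOfRecord (Slots assembly step outA outB)
open Summit.QuantumFields.BalabanUV.T4Continuum.B13StepOfRecordSub (assemblyOn restrict opA_mem_measOp opB_mem_measOp)
open Summit.QuantumFields.BalabanUV.T4Continuum.B13StepOfRecordReadAt (readAtSlots transportReads_record_readAt)
open Summit.QuantumFields.BalabanUV.T4Continuum.B13OpMeasurable (measOp)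
open Summit.QuantumFields.BalabanUV.T4Continuum.B13TermOpEnvelope (ActOpLineAnalyticOn)
open Summit.QuantumFields.BalabanUV.T4Continuum.B13StepEnvelopeEndUniform
  (uniform_ne5_of_record_envelope uniform_ne5_of_record_restrict_envelope)
open Summit.QuantumFields.BalabanUV.T4Continuum.OutputRateWindow (ne5_of_forall_singleton)

/-! ## §1 The η-uniform Cauchy END face on the operator carrier of record `↥measOp` -/

section MeasOp

/-- [folklore] **THE η-UNIFORM CAUCHY END FACE OF RECORD ON THE MEASURABLE OPERATOR CARRIER `↥measOp` (R20 of record), `∃ C₅`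
OUTERMOST.**  Part 1's `B13StepEnvelopeEndUniform.uniform_ne5_of_record_restrict_envelope` at `M := measOp T κ ι Ω 𝒴` for slot packages
on row O1-b's species type READ AT THE TRANSPORTED BACKGROUND (`readAtSlots S₀ ι′`, the reading BY CONSTRUCTION —
`transportReads_record_readAt`) with the two membership side conditions DISCHARGED from the one-run MEASURABILITY side conditions of
printed KIND (`B13StepOfRecordSub.opA_mem_measOp`∕`opB_mem_measOp`): the binder list is that of
`B13StepEnvelopeEndMeasOp.exists_ne5_of_record_measOp_envelope_readAt` (p217285) VERBATIM, the constant now fixed from the sizes BEFORE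
the pair of runs ∕ slot package ∕ reading ∕ window are bound — ONE `C₅` for all of them.  NOT a proof of NE5. -/
theorem uniform_ne5_of_record_measOp_envelope_readAt {κ' Φ' EA₀ E₀ cA cB c₁ r₀ δ' θ θ' ω : ℝ}
    (hE₀ : 0 ≤ E₀) (hκ : 0 ≤ κ') (hΦ0 : 0 ≤ Φ') (hΦsmall : 36 * Φ' < 1) (hcA : 0 ≤ cA) (hcB : 0 ≤ cB) (hc₁ : 0 ≤ c₁)
    (hr₀ : 0 < r₀) (hδ' : 0 ≤ δ') (hθ0 : 0 < θ) (hθ1 : θ < 1) (hθθ' : θ ≤ θ') (hθ'1 : θ' ≤ 1) (hω : 0 < ω) (hω1 : ω < 1)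
    (hh : cA * (EA₀ + E₀) < 1 - ω) (hsmall : ω + Φ' / (1 - 36 * Φ') * cA * (1 - ω) / (1 - ω - cA * (EA₀ + E₀)) < θ') :
    ∃ C₅ : ℝ, ∀ {𝔾 : Type} [GaugeGroup 𝔾] {R : TwoRuns 𝔾} {T κ ι Ω 𝒴 IOp Hist Ω' : Type*} [MeasurableSpace Ω]
      [NormedAddCommGroup Hist] [NormedSpace ℂ Hist] [MeasurableSpace Ω'] (S₀ : Slots R (Species T κ ι Ω 𝒴) IOp Hist)
      (ι' : (ℕ → ℝ) → R.carriers.BgA → ℕ → IOp)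
      (hbdA : ∀ g V k, FormatBounded (S₀.F k) (S₀.rawA g V k))
      (hrawQA : ∀ g V k (Y : 𝒴) (b b' : κ), Measurable fun x : Ω => S₀.rawA g V k (.potQ x Y b b'))
      (hrawRA : ∀ g V k (Y : 𝒴), Measurable fun x : Ω => S₀.rawA g V k (.potR x Y))
      (hbdB : ∀ g U k, FormatBounded (S₀.F k) (S₀.rawB g U k))
      (hrawQB : ∀ g U k (Y : 𝒴) (b b' : κ), Measurable fun x : Ω => S₀.rawB g U k (.potQ x Y b b'))
      (hrawRB : ∀ g U k (Y : 𝒴), Measurable fun x : Ω => S₀.rawB g U k (.potR x Y))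
      (hFQ : ∀ k (Y : 𝒴) (b b' : κ), Measurable fun x : Ω => (S₀.F k).wt (.potQ x Y b b'))
      (hFR : ∀ k (Y : 𝒴), Measurable fun x : Ω => (S₀.F k).wt (.potR x Y))
      {W : Set (ℕ → ℝ)} {ROp RHist : ℕ → ℝ}
      {A A' : ℕ → (ℕ → ℝ) → R.carriers.BgB → R.carriers.Dom → InnerLabel R.carriers.Dom (Bnd R) → ℝ}
      {Dt : ActData R.carriers.Dom (InnerLabel R.carriers.Dom (Bnd R)) (measOp T κ ι Ω 𝒴) Hist Ω'},
      S₀.D.ω = ω →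
      (assembly (readAtSlots S₀ ι')).SliceBudgetB W κ' cB →
      (readAtSlots S₀ ι').D.SliceBudget (step (readAtSlots S₀ ι') E₀ cB) W κ' cA →
      DecayBound (outA (readAtSlots S₀ ι') E₀ cB) W EA₀ κ' → DecayBound (outB (readAtSlots S₀ ι') E₀ cB) W E₀ κ' →
      RawBounded S₀.F (assembly S₀).rawAt W → RawBounded S₀.F S₀.rawB W →
      WeightedEntrywiseRate S₀.F (assembly S₀).rawAt S₀.rawB W c₁ (fun k => θ ^ k) → (∀ k, r₀ ≤ S₀.rOp k) →
      (step (readAtSlots S₀ ι') E₀ cB).InsertionRate W κ' E₀ δ' θ →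
      (∀ k, S₀.rOp k ≤ ROp k) → (∀ k, (assembly S₀).bHist E₀ cB k + S₀.rHist k ≤ RHist k) →
      (∀ k, ∀ g ∈ W, ∀ (U : R.carriers.BgB) (q : measOp T κ ι Ω 𝒴 × Hist),
        q ∈ ballClass (selfCtr
            (assemblyOn (restrict (readAtSlots S₀ ι') (measOp T κ ι Ω 𝒴)
              (opA_mem_measOp S₀ hbdA hrawQA hrawRA hFQ hFR) (opB_mem_measOp S₀ hbdB hrawQB hrawRB hFQ hFR))).raw
            (assemblyOn (restrict (readAtSlots S₀ ι') (measOp T κ ι Ω 𝒴)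
              (opA_mem_measOp S₀ hbdA hrawQA hrawRA hFQ hFR) (opB_mem_measOp S₀ hbdB hrawQB hrawRB hFQ hFR))).histRef) ROp RHist k g U →
          ∀ X : R.carriers.Dom, R.carriers.scale X = k → ∀ i : TermIdx R.carriers.Dom (Bnd R),
            (labelsIndexing (domainGeometry R) (b13InnerData R)).Rel k i X → ∀ m,
              ‖S₀.act ((labelsIndexing (domainGeometry R) (b13InnerData R)).poly i m)
                  ((labelsIndexing (domainGeometry R) (b13InnerData R)).lab i m) (q.1 : OpDatum (Species T κ ι Ω 𝒴)) q.2‖ ≤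
                A k g U ((labelsIndexing (domainGeometry R) (b13InnerData R)).poly i m)
                  ((labelsIndexing (domainGeometry R) (b13InnerData R)).lab i m)) →
      (∀ k g U Z ℓ, 0 ≤ A k g U Z ℓ) → (∀ k g U Z ℓ, 0 ≤ A' k g U Z ℓ) →
      (∀ k g U Z ℓ, A k g U Z ℓ ≤ A' k g U Z ℓ * Real.exp (-(κ' * (R.carriers.d Z + 5)))) →
      (∀ k, ∀ g ∈ W, ∀ (U : R.carriers.BgB) (q : SCube R),
        ∑ Z ∈ R.domAt k, ind (q ∈ footprint Z) * actSum (b13InnerData R) (A' k g U) k Z * Real.exp ((footprint Z).card) ≤ Φ') →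
      ActOpLineAnalyticOn (labelsIndexing (domainGeometry R) (b13InnerData R))
        (restrict (readAtSlots S₀ ι') (measOp T κ ι Ω 𝒴)
          (opA_mem_measOp S₀ hbdA hrawQA hrawRA hFQ hFR) (opB_mem_measOp S₀ hbdB hrawQB hrawRB hFQ hFR)).act
        (ballClass (selfCtr
            (assemblyOn (restrict (readAtSlots S₀ ι') (measOp T κ ι Ω 𝒴)
              (opA_mem_measOp S₀ hbdA hrawQA hrawRA hFQ hFR) (opB_mem_measOp S₀ hbdB hrawQB hrawRB hFQ hFR))).raw
            (assemblyOn (restrict (readAtSlots S₀ ι') (measOp T κ ι Ω 𝒴)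
              (opA_mem_measOp S₀ hbdA hrawQA hrawRA hFQ hFR) (opB_mem_measOp S₀ hbdB hrawQB hrawRB hFQ hFR))).histRef) ROp RHist) W →
      ActExpLinearOn (labelsIndexing (domainGeometry R) (b13InnerData R))
        (restrict (readAtSlots S₀ ι') (measOp T κ ι Ω 𝒴)
          (opA_mem_measOp S₀ hbdA hrawQA hrawRA hFQ hFR) (opB_mem_measOp S₀ hbdB hrawQB hrawRB hFQ hFR)).act Dt
        (ballClass (selfCtr
            (assemblyOn (restrict (readAtSlots S₀ ι') (measOp T κ ι Ω 𝒴)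
              (opA_mem_measOp S₀ hbdA hrawQA hrawRA hFQ hFR) (opB_mem_measOp S₀ hbdB hrawQB hrawRB hFQ hFR))).raw
            (assemblyOn (restrict (readAtSlots S₀ ι') (measOp T κ ι Ω 𝒴)
              (opA_mem_measOp S₀ hbdA hrawQA hrawRA hFQ hFR) (opB_mem_measOp S₀ hbdB hrawQB hrawRB hFQ hFR))).histRef) ROp RHist) W →
      NE5 (outA (readAtSlots S₀ ι') E₀ cB) (outB (readAtSlots S₀ ι') E₀ cB) W κ' θ' C₅ := by
  obtain ⟨C₅, h⟩ := uniform_ne5_of_record_restrict_envelope (κ := κ') hE₀ hκ hΦ0 hΦsmall hcA hcB hc₁ hr₀ hδ' hθ0 hθ1 hθθ' hθ'1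
    hω hω1 hh hsmall
  refine ⟨C₅, ?_⟩
  intro 𝔾 _ R T κ ι Ω 𝒴 IOp Hist Ω' _ _ _ _ S₀ ι' hbdA hrawQA hrawRA hbdB hrawQB hrawRB hFQ hFR W ROp RHist A A' Dt hSω hbB hbA hdA hdB
    hRA hRB hwer hfl hins hOp hHist hA hA0 hA0' hdec hΦ hact hexp
  exact h (readAtSlots S₀ ι') (measOp T κ ι Ω 𝒴) (opA_mem_measOp S₀ hbdA hrawQA hrawRA hFQ hFR)
    (opB_mem_measOp S₀ hbdB hrawQB hrawRB hFQ hFR) hSω (transportReads_record_readAt S₀ ι' W) hbB hbA hdA hdB hRA hRB hwer hfl hins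
    hOp hHist hA hA0 hA0' hdec hΦ hact hexp
end MeasOp

/-! ## §2 Singleton windows (R24 × R29′): the η-uniform Cauchy faces are g-uniform across `{g}`, `g ∈ W` -/

section Singleton

/-- [folklore] **THE η-UNIFORM CAUCHY FACE OF RECORD IS g-UNIFORM ACROSS SINGLETON WINDOWS.**  Sizes and size inequalities as in part 1's
`B13StepEnvelopeEndUniform.uniform_ne5_of_record_envelope`.  Then ONE constant `C₅` serves every pair of runs `R`, every slot package `S` with `S.D.ω = ω`, every
window `W` and EVERY COUPLING `g ∈ W` SEPARATELY: if each displayed binder of E9[rec] holds AT THE SINGLETON WINDOW `{g}` for every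
`g ∈ W` — the transport reading, the two one-run slice budgets, the levels `DecayBound (outA S E₀ cB) {g} EA₀ κ` ∕
`DecayBound (outB S E₀ cB) {g} E₀ κ`, bounded raw suppliers + row NE2's weighted entrywise rate `c₁·θ^k` + floor, W4
`InsertionRate {g} κ E₀ δ′ θ`, and the activity-level W2 data on the roomy class with g-INDEXED dictionaries: a norm majorant `A g` with
decay split into `A′ g` (both nonnegative) whose anchored norm is at most the COMMON `Φ′`, **`ActOpLineAnalyticOn … {g}`** and
`ActExpLinearOn … (Dt g) … {g}` —, then `NE5 (outA S E₀ cB) (outB S E₀ cB) W κ θ′ C₅`.  (R24's «g-indexed dictionaries on singleton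
windows, then reassemble», at no cost in the constant; proof = part 1's `uniform_ne5_of_record_envelope` ∘ the owner's `OutputRateWindow.ne5_of_forall_singleton`.)
NOT a proof of NE5: an implication from displayed binders. -/
theorem uniform_ne5_of_record_envelope_singleton {κ Φ' EA₀ E₀ cA cB c₁ r₀ δ' θ θ' ω : ℝ}
    (hE₀ : 0 ≤ E₀) (hκ : 0 ≤ κ) (hΦ0 : 0 ≤ Φ') (hΦsmall : 36 * Φ' < 1) (hcA : 0 ≤ cA) (hcB : 0 ≤ cB) (hc₁ : 0 ≤ c₁)
    (hr₀ : 0 < r₀) (hδ' : 0 ≤ δ') (hθ0 : 0 < θ) (hθ1 : θ < 1) (hθθ' : θ ≤ θ') (hθ'1 : θ' ≤ 1) (hω : 0 < ω) (hω1 : ω < 1)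
    (hh : cA * (EA₀ + E₀) < 1 - ω) (hsmall : ω + Φ' / (1 - 36 * Φ') * cA * (1 - ω) / (1 - ω - cA * (EA₀ + E₀)) < θ') :
    ∃ C₅ : ℝ, ∀ {𝔾 : Type} [GaugeGroup 𝔾] {R : TwoRuns 𝔾} {E IOp Hist Ω : Type*} [NormedAddCommGroup Hist] [NormedSpace ℂ Hist]
      [MeasurableSpace Ω] (S : Slots R E IOp Hist) {W : Set (ℕ → ℝ)} {ROp RHist : ℕ → ℝ}
      {A A' : (ℕ → ℝ) → ℕ → (ℕ → ℝ) → R.carriers.BgB → R.carriers.Dom → InnerLabel R.carriers.Dom (Bnd R) → ℝ}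
      {Dt : (ℕ → ℝ) → ActData R.carriers.Dom (InnerLabel R.carriers.Dom (Bnd R)) (OpDatum E) Hist Ω},
      S.D.ω = ω →
      (∀ g ∈ W, (assembly S).TransportReads {g}) →
      (∀ g ∈ W, (assembly S).SliceBudgetB {g} κ cB) → (∀ g ∈ W, S.D.SliceBudget (step S E₀ cB) {g} κ cA) →
      (∀ g ∈ W, DecayBound (outA S E₀ cB) {g} EA₀ κ) → (∀ g ∈ W, DecayBound (outB S E₀ cB) {g} E₀ κ) →
      (∀ g ∈ W, RawBounded S.F (assembly S).rawAt {g}) → (∀ g ∈ W, RawBounded S.F S.rawB {g}) →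
      (∀ g ∈ W, WeightedEntrywiseRate S.F (assembly S).rawAt S.rawB {g} c₁ (fun k => θ ^ k)) → (∀ k, r₀ ≤ S.rOp k) →
      (∀ g ∈ W, (step S E₀ cB).InsertionRate {g} κ E₀ δ' θ) →
      (∀ k, S.rOp k ≤ ROp k) → (∀ k, (assembly S).bHist E₀ cB k + S.rHist k ≤ RHist k) →
      (∀ g ∈ W, ∀ k, ∀ g' ∈ ({g} : Set (ℕ → ℝ)), ∀ (U : R.carriers.BgB) (q : OpDatum E × Hist),
        q ∈ ballClass (selfCtr (assembly S).raw (assembly S).histRef) ROp RHist k g' U → ∀ X : R.carriers.Dom,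
          R.carriers.scale X = k → ∀ i : TermIdx R.carriers.Dom (Bnd R), (labelsIndexing (domainGeometry R) (b13InnerData R)).Rel k i X →
            ∀ m, ‖S.act ((labelsIndexing (domainGeometry R) (b13InnerData R)).poly i m)
                ((labelsIndexing (domainGeometry R) (b13InnerData R)).lab i m) q.1 q.2‖ ≤
              A g k g' U ((labelsIndexing (domainGeometry R) (b13InnerData R)).poly i m)
                ((labelsIndexing (domainGeometry R) (b13InnerData R)).lab i m)) →
      (∀ g ∈ W, ∀ k g' U Z ℓ, 0 ≤ A g k g' U Z ℓ) → (∀ g ∈ W, ∀ k g' U Z ℓ, 0 ≤ A' g k g' U Z ℓ) →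
      (∀ g ∈ W, ∀ k g' U Z ℓ, A g k g' U Z ℓ ≤ A' g k g' U Z ℓ * Real.exp (-(κ * (R.carriers.d Z + 5)))) →
      (∀ g ∈ W, ∀ k, ∀ g' ∈ ({g} : Set (ℕ → ℝ)), ∀ (U : R.carriers.BgB) (q : SCube R),
        ∑ Z ∈ R.domAt k, ind (q ∈ footprint Z) * actSum (b13InnerData R) (A' g k g' U) k Z * Real.exp ((footprint Z).card) ≤ Φ') →
      (∀ g ∈ W, ActOpLineAnalyticOn (labelsIndexing (domainGeometry R) (b13InnerData R)) S.act
        (ballClass (selfCtr (assembly S).raw (assembly S).histRef) ROp RHist) {g}) →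
      (∀ g ∈ W, ActExpLinearOn (labelsIndexing (domainGeometry R) (b13InnerData R)) S.act (Dt g)
        (ballClass (selfCtr (assembly S).raw (assembly S).histRef) ROp RHist) {g}) →
      NE5 (outA S E₀ cB) (outB S E₀ cB) W κ θ' C₅ := by
  obtain ⟨C₅, h⟩ := uniform_ne5_of_record_envelope (κ := κ) hE₀ hκ hΦ0 hΦsmall hcA hcB hc₁ hr₀ hδ' hθ0 hθ1 hθθ' hθ'1 hω hω1 hh
    hsmall
  refine ⟨C₅, ?_⟩
  intro 𝔾 _ R E IOp Hist Ω _ _ _ S W ROp RHist A A' Dt hSω hT hbB hbA hdA hdB hRA hRB hwer hfl hins hOp hHist hA hA0 hA0' hdec hΦ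
    hact hexp
  exact ne5_of_forall_singleton fun g hg =>
    h S hSω (hT g hg) (hbB g hg) (hbA g hg) (hdA g hg) (hdB g hg) (hRA g hg) (hRB g hg) (hwer g hg) hfl (hins g hg) hOp hHist
      (hA g hg) (hA0 g hg) (hA0' g hg) (hdec g hg) (hΦ g hg) (hact g hg) (hexp g hg)

/-- [folklore] **THE η-UNIFORM RE-POINTED CAUCHY FACE IS g-UNIFORM ACROSS SINGLETON WINDOWS** — §2's first face for part 1's
`B13StepEnvelopeEndUniform.uniform_ne5_of_record_restrict_envelope`: every displayed binder PER SINGLETON `{g}` (operator-ball binders over `↥M` with g-indexed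
`A g`, `A′ g`, `Dt g`), the sub-slot `M ∋` the data of record and the sizes COMMON; ONE `C₅` for every pair of runs, slot package
(`S₀.D.ω = ω`), sub-slot, window and coupling; conclusion `NE5 (B13StepOfRecord.outA S₀ E₀ cB) (B13StepOfRecord.outB S₀ E₀ cB) W κ θ′ C₅`. -/
theorem uniform_ne5_of_record_restrict_envelope_singleton {κ Φ' EA₀ E₀ cA cB c₁ r₀ δ' θ θ' ω : ℝ}
    (hE₀ : 0 ≤ E₀) (hκ : 0 ≤ κ) (hΦ0 : 0 ≤ Φ') (hΦsmall : 36 * Φ' < 1) (hcA : 0 ≤ cA) (hcB : 0 ≤ cB) (hc₁ : 0 ≤ c₁)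
    (hr₀ : 0 < r₀) (hδ' : 0 ≤ δ') (hθ0 : 0 < θ) (hθ1 : θ < 1) (hθθ' : θ ≤ θ') (hθ'1 : θ' ≤ 1) (hω : 0 < ω) (hω1 : ω < 1)
    (hh : cA * (EA₀ + E₀) < 1 - ω) (hsmall : ω + Φ' / (1 - 36 * Φ') * cA * (1 - ω) / (1 - ω - cA * (EA₀ + E₀)) < θ') :
    ∃ C₅ : ℝ, ∀ {𝔾 : Type} [GaugeGroup 𝔾] {R : TwoRuns 𝔾} {E IOp Hist Ω : Type*} [NormedAddCommGroup Hist] [NormedSpace ℂ Hist]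
      [MeasurableSpace Ω] (S₀ : Slots R E IOp Hist) (M : Submodule ℂ (OpDatum E))
      (hMA : ∀ g V k, opOf S₀.F S₀.rawA g V k ∈ M) (hMB : ∀ g U k, opOf S₀.F S₀.rawB g U k ∈ M)
      {W : Set (ℕ → ℝ)} {ROp RHist : ℕ → ℝ}
      {A A' : (ℕ → ℝ) → ℕ → (ℕ → ℝ) → R.carriers.BgB → R.carriers.Dom → InnerLabel R.carriers.Dom (Bnd R) → ℝ}
      {Dt : (ℕ → ℝ) → ActData R.carriers.Dom (InnerLabel R.carriers.Dom (Bnd R)) M Hist Ω},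
      S₀.D.ω = ω →
      (∀ g ∈ W, (assembly S₀).TransportReads {g}) →
      (∀ g ∈ W, (assembly S₀).SliceBudgetB {g} κ cB) → (∀ g ∈ W, S₀.D.SliceBudget (step S₀ E₀ cB) {g} κ cA) →
      (∀ g ∈ W, DecayBound (outA S₀ E₀ cB) {g} EA₀ κ) → (∀ g ∈ W, DecayBound (outB S₀ E₀ cB) {g} E₀ κ) →
      (∀ g ∈ W, RawBounded S₀.F (assembly S₀).rawAt {g}) → (∀ g ∈ W, RawBounded S₀.F S₀.rawB {g}) →
      (∀ g ∈ W, WeightedEntrywiseRate S₀.F (assembly S₀).rawAt S₀.rawB {g} c₁ (fun k => θ ^ k)) → (∀ k, r₀ ≤ S₀.rOp k) →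
      (∀ g ∈ W, (step S₀ E₀ cB).InsertionRate {g} κ E₀ δ' θ) →
      (∀ k, S₀.rOp k ≤ ROp k) → (∀ k, (assembly S₀).bHist E₀ cB k + S₀.rHist k ≤ RHist k) →
      (∀ g ∈ W, ∀ k, ∀ g' ∈ ({g} : Set (ℕ → ℝ)), ∀ (U : R.carriers.BgB) (q : M × Hist),
        q ∈ ballClass (selfCtr (assemblyOn (restrict S₀ M hMA hMB)).raw (assemblyOn (restrict S₀ M hMA hMB)).histRef) ROp RHist k g' U →
          ∀ X : R.carriers.Dom, R.carriers.scale X = k → ∀ i : TermIdx R.carriers.Dom (Bnd R),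
            (labelsIndexing (domainGeometry R) (b13InnerData R)).Rel k i X → ∀ m,
              ‖S₀.act ((labelsIndexing (domainGeometry R) (b13InnerData R)).poly i m)
                  ((labelsIndexing (domainGeometry R) (b13InnerData R)).lab i m) (q.1 : OpDatum E) q.2‖ ≤
                A g k g' U ((labelsIndexing (domainGeometry R) (b13InnerData R)).poly i m)
                  ((labelsIndexing (domainGeometry R) (b13InnerData R)).lab i m)) →
      (∀ g ∈ W, ∀ k g' U Z ℓ, 0 ≤ A g k g' U Z ℓ) → (∀ g ∈ W, ∀ k g' U Z ℓ, 0 ≤ A' g k g' U Z ℓ) →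
      (∀ g ∈ W, ∀ k g' U Z ℓ, A g k g' U Z ℓ ≤ A' g k g' U Z ℓ * Real.exp (-(κ * (R.carriers.d Z + 5)))) →
      (∀ g ∈ W, ∀ k, ∀ g' ∈ ({g} : Set (ℕ → ℝ)), ∀ (U : R.carriers.BgB) (q : SCube R),
        ∑ Z ∈ R.domAt k, ind (q ∈ footprint Z) * actSum (b13InnerData R) (A' g k g' U) k Z * Real.exp ((footprint Z).card) ≤ Φ') →
      (∀ g ∈ W, ActOpLineAnalyticOn (labelsIndexing (domainGeometry R) (b13InnerData R)) (restrict S₀ M hMA hMB).act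
        (ballClass (selfCtr (assemblyOn (restrict S₀ M hMA hMB)).raw (assemblyOn (restrict S₀ M hMA hMB)).histRef) ROp RHist) {g}) →
      (∀ g ∈ W, ActExpLinearOn (labelsIndexing (domainGeometry R) (b13InnerData R)) (restrict S₀ M hMA hMB).act (Dt g)
        (ballClass (selfCtr (assemblyOn (restrict S₀ M hMA hMB)).raw (assemblyOn (restrict S₀ M hMA hMB)).histRef) ROp RHist) {g}) →
      NE5 (outA S₀ E₀ cB) (outB S₀ E₀ cB) W κ θ' C₅ := by
  obtain ⟨C₅, h⟩ := uniform_ne5_of_record_restrict_envelope (κ := κ) hE₀ hκ hΦ0 hΦsmall hcA hcB hc₁ hr₀ hδ' hθ0 hθ1 hθθ' hθ'1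
    hω hω1 hh hsmall
  refine ⟨C₅, ?_⟩
  intro 𝔾 _ R E IOp Hist Ω _ _ _ S₀ M hMA hMB W ROp RHist A A' Dt hSω hT hbB hbA hdA hdB hRA hRB hwer hfl hins hOp hHist hA hA0 hA0'
    hdec hΦ hact hexp
  exact ne5_of_forall_singleton fun g hg =>
    h S₀ M hMA hMB hSω (hT g hg) (hbB g hg) (hbA g hg) (hdA g hg) (hdB g hg) (hRA g hg) (hRB g hg) (hwer g hg) hfl (hins g hg) hOp
      hHist (hA g hg) (hA0 g hg) (hA0' g hg) (hdec g hg) (hΦ g hg) (hact g hg) (hexp g hg)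

end Singleton

end Summit.QuantumFields.BalabanUV.T4Continuum.B13StepEnvelopeEndWindow

end
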